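import Literature.NumberTheory.LFunctions.MertensSecondExpSqrt
import Literature.NumberTheory.LFunctions.GranvilleSoundararajanCosIntegral
import HarnessLib

/-!
# Granville–Soundararajan 2003, proof of Lemma 2.3: `∑_{p ≤ x} |cos((β/2) log p)|/p`

Topic `Literature/NumberTheory/LFunctions`. Everything in this file is PROVED (no named facts).
This is the prime-sum estimate at the heart of Lemma 2.3 of Granville–Soundararajan, *Decay of
mean values of multiplicative functions* (arXiv math/9911246, p. 5): for `x ≥ 3` and
`1/log x ≤ |β| ≤ log x`,

`∑_{p ≤ x} |cos((β/2) log p)|/p ≤ (2/π) log log x + (1 - 2/π) log max(1/|β|, (log log x)²) + O(1)`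

(`sum_abs_cos_log_prime_div_le`).  The printed proof: put `Y = max(exp(C (log log x)²), e^{1/|β|})`
(`C = 100/c²`, `c` the constant in the prime number theorem `∑_{w ≤ p ≤ z} 1/p = ∫_w^z dt/(t log t)
+ O(exp(-c√log w))`, here `Literature.NumberTheory.LFunctions.Mertens.abs_primeRecipSum_window_sub_le_expSqrt`);
bound the primes `p ≤ Y` trivially by Mertens (`∑_{p ≤ Y} 1/p ≤ log log Y + O(1)`,
`Literature.NumberTheory.LFunctions.MertensBound.sum_inv_prime_le`); cover `[Y, x]` by short
intervals on which `|cos((β/2) log p)|` is constant up to `O(δ|β|)` (this uses `|β| ≤ log x`) and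
apply the prime number theorem on each, getting
`∑_{Y ≤ p ≤ x} |cos((β/2) log p)|/p = ∫_{log Y}^{log x} |cos(βu/2)| du/u + O(1)`
(`cosLogSum_sub_le_integral`, with `(log x)³`-many windows in the variable `u = log p`); finally
`∫ |cos(βu/2)| du/u ≤ (2/π) log(log x/log Y) + O(1)` as the mean value of `|cos|` is `2/π` and
`|β| log Y ≥ 1` (`integral_abs_cos_mul_div_le` of `GranvilleSoundararajanCosIntegral.lean`).
The implied constant is absolute; small `x` (`log log x < 1`) are absorbed into it.

## References

* A. Granville, K. Soundararajan, *Decay of mean values of multiplicative functions*, Canad. J.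
  Math. 55 (2003), 1191–1230, Lemma 2.3 and its proof (arXiv math/9911246, p. 5).
  [GranvilleSoundararajan2003]
-/

noncomputable section

open Real MeasureTheory Set intervalIntegral Finset
open Literature.NumberTheory.LFunctions.Mertens

namespace Literature.NumberTheory.LFunctions.GranvilleSoundararajan

/-! ### One window `(t, t']` of primes -/

/-- On a window of primes `t < p ≤ t'` where `|cos((β/2) log p)| ≤ c₀`:
`∑_{p ≤ t'} |cos((β/2)log p)|/p - ∑_{p ≤ t} |cos((β/2)log p)|/p ≤ c₀ (∑_{p ≤ t'} 1/p - ∑_{p ≤ t} 1/p)`.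
[cite: GranvilleSoundararajan2003, proof of Lemma 2.3] -/
theorem cosLogSum_window_le {β t t' c₀ : ℝ} (ht : 0 ≤ t) (htt' : t ≤ t')
    (hc : ∀ p : ℕ, p.Prime → t < p → (p : ℝ) ≤ t' → |Real.cos (β / 2 * Real.log p)| ≤ c₀) :
    (∑ p ∈ Nat.primesLE ⌊t'⌋₊, |Real.cos (β / 2 * Real.log p)| / p) -
        ∑ p ∈ Nat.primesLE ⌊t⌋₊, |Real.cos (β / 2 * Real.log p)| / p ≤
      c₀ * (primeRecipSum t' - primeRecipSum t) := by
  have ht' : 0 ≤ t' := ht.trans htt'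
  rw [primeRecipSum, primeRecipSum, ← sum_primesLE_filter_lt_eq_sub _ ht htt',
    ← sum_primesLE_filter_lt_eq_sub _ ht htt', Finset.mul_sum]
  refine Finset.sum_le_sum fun p hp => ?_
  rw [Finset.mem_filter, Nat.mem_primesLE] at hp
  obtain ⟨⟨hple, hpp⟩, htp⟩ := hp
  have hp0 : (0 : ℝ) < p := by exact_mod_cast hpp.pos
  have hpt' : (p : ℝ) ≤ t' := le_trans (by exact_mod_cast hple) (Nat.floor_le ht')
  rw [div_eq_mul_inv]
  exact mul_le_mul_of_nonneg_right (hc p hpp htp hpt') (inv_nonneg.mpr hp0.le)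

/-- `|cos((β/2) u)| ≤ |cos((β/2) u₀)| + (|β|/2) h` when `|u - u₀| ≤ h` (`cos` is `1`-Lipschitz).
[folklore] -/
theorem abs_cos_mul_le_of_abs_sub_le {β u u₀ h : ℝ} (hu : |u - u₀| ≤ h) :
    |Real.cos (β / 2 * u)| ≤ |Real.cos (β / 2 * u₀)| + |β| / 2 * h := by
  have h1 : |Real.cos (β / 2 * u) - Real.cos (β / 2 * u₀)| ≤ |β| / 2 * h := by
    refine (Real.abs_cos_sub_cos_le _ _).trans ?_
    rw [← mul_sub, abs_mul, abs_div, abs_two]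
    exact mul_le_mul_of_nonneg_left hu (by positivity)
  have h2 := abs_sub_abs_le_abs_sub (Real.cos (β / 2 * u)) (Real.cos (β / 2 * u₀))
  linarith

/-- `u ↦ |cos((β/2) u)|/u` is continuous on `[u₀, u₁]` for `u₀ > 0`. [folklore] -/
theorem continuousOn_abs_cos_mul_div {β u₀ u₁ : ℝ} (hu₀ : 0 < u₀) (hu₀₁ : u₀ ≤ u₁) :
    ContinuousOn (fun u : ℝ => |Real.cos (β / 2 * u)| / u) (uIcc u₀ u₁) := by
  refine ContinuousOn.div ?_ continuousOn_id fun u hu => ?_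
  · exact (continuous_abs.comp (Real.continuous_cos.comp (continuous_const.mul continuous_id))).continuousOn
  · rw [uIcc_of_le hu₀₁] at hu
    exact (hu₀.trans_le hu.1).ne'

/-- The window weight against `log`: for `0 < u₀ ≤ u₁`, `h = u₁ - u₀`,
`|cos((β/2)u₀)| (log u₁ - log u₀) ≤ ∫_{u₀}^{u₁} |cos((β/2)u)| du/u + (|β|/2) h (log u₁ - log u₀)`.
[cite: GranvilleSoundararajan2003, proof of Lemma 2.3] -/
theorem abs_cos_mul_log_sub_le_integral {β u₀ u₁ : ℝ} (hu₀ : 0 < u₀) (hu₀₁ : u₀ ≤ u₁) :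
    |Real.cos (β / 2 * u₀)| * (Real.log u₁ - Real.log u₀) ≤
      (∫ u in u₀..u₁, |Real.cos (β / 2 * u)| / u) +
        |β| / 2 * (u₁ - u₀) * (Real.log u₁ - Real.log u₀) := by
  have hmem : ∀ u ∈ uIcc u₀ u₁, 0 < u := by
    intro u hu
    rw [uIcc_of_le hu₀₁] at hu
    exact hu₀.trans_le hu.1
  have hlog : Real.log u₁ - Real.log u₀ = ∫ u in u₀..u₁, u⁻¹ := by
    rw [integral_inv (fun h0 => (lt_irrefl (0 : ℝ)) (hmem 0 h0)), Real.log_div (by linarith) hu₀.ne']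
  have hinv : IntervalIntegrable (fun u : ℝ => u⁻¹) volume u₀ u₁ :=
    (ContinuousOn.inv₀ continuousOn_id fun u hu => (hmem u hu).ne').intervalIntegrable
  have hcos : IntervalIntegrable (fun u : ℝ => |Real.cos (β / 2 * u)| / u) volume u₀ u₁ :=
    (continuousOn_abs_cos_mul_div hu₀ hu₀₁).intervalIntegrable
  rw [hlog, ← intervalIntegral.integral_const_mul, ← intervalIntegral.integral_const_mul,
    ← intervalIntegral.integral_add hcos (hinv.const_mul _)]
  refine integral_mono_on hu₀₁ (hinv.const_mul _) (hcos.add (hinv.const_mul _)) fun u hu => ?_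
  have hu0 : 0 < u := hu₀.trans_le hu.1
  have hsub : |u₀ - u| ≤ u₁ - u₀ := by
    rw [abs_sub_comm, abs_of_nonneg (by linarith [hu.1])]
    linarith [hu.2]
  have hlip := abs_cos_mul_le_of_abs_sub_le (β := β) hsub
  calc |Real.cos (β / 2 * u₀)| * u⁻¹ ≤ (|Real.cos (β / 2 * u)| + |β| / 2 * (u₁ - u₀)) * u⁻¹ :=
        mul_le_mul_of_nonneg_right hlip (inv_nonneg.mpr hu0.le)
    _ = |Real.cos (β / 2 * u)| / u + |β| / 2 * (u₁ - u₀) * u⁻¹ := by ring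

/-! ### Covering `[Y, x]` by windows -/

/-- **Discretisation** (the covering of `[Y, x]` by short intervals in the printed proof, in the
variable `u = log p`): let `0 < Λ ≤ ℓ`, `N ≥ 1`, `h = (ℓ - Λ)/N`, `u_j = Λ + j h`, and suppose that on
each window `∑_{e^{u_j} < p ≤ e^{u_{j+1}}} 1/p ≤ log u_{j+1} - log u_j + E` (`E ≥ 0`; this is the prime
number theorem). Then
`∑_{e^Λ < p ≤ e^ℓ} |cos((β/2) log p)|/p ≤ ∫_Λ^ℓ |cos((β/2)u)| du/u + |β| h (log ℓ - log Λ) + N (1 + |β|h/2) E`.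
[cite: GranvilleSoundararajan2003, proof of Lemma 2.3] -/
theorem cosLogSum_sub_le_integral (β : ℝ) {Λ ℓ : ℝ} (hΛ : 0 < Λ) (hΛℓ : Λ ≤ ℓ) {N : ℕ} (hN : 0 < N)
    {E : ℝ} (hE : 0 ≤ E)
    (hwin : ∀ j : ℕ, j < N →
      primeRecipSum (Real.exp (Λ + (j + 1 : ℕ) * ((ℓ - Λ) / N))) -
          primeRecipSum (Real.exp (Λ + j * ((ℓ - Λ) / N))) ≤
        Real.log (Λ + (j + 1 : ℕ) * ((ℓ - Λ) / N)) - Real.log (Λ + j * ((ℓ - Λ) / N)) + E) :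
    (∑ p ∈ Nat.primesLE ⌊Real.exp ℓ⌋₊, |Real.cos (β / 2 * Real.log p)| / p) -
        ∑ p ∈ Nat.primesLE ⌊Real.exp Λ⌋₊, |Real.cos (β / 2 * Real.log p)| / p ≤
      (∫ u in Λ..ℓ, |Real.cos (β / 2 * u)| / u) + |β| * ((ℓ - Λ) / N) * (Real.log ℓ - Real.log Λ) +
        N * (1 + |β| * ((ℓ - Λ) / N) / 2) * E := by
  set h : ℝ := (ℓ - Λ) / N with hh
  set u : ℕ → ℝ := fun j => Λ + j * h with hu
  set W : ℝ → ℝ := fun t => ∑ p ∈ Nat.primesLE ⌊t⌋₊, |Real.cos (β / 2 * Real.log p)| / p with hW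
  have hN0 : (N : ℝ) ≠ 0 := by exact_mod_cast hN.ne'
  have hh0 : 0 ≤ h := div_nonneg (by linarith) (Nat.cast_nonneg N)
  have hu0 : u 0 = Λ := by simp [hu]
  have huN : u N = ℓ := by simp only [hu, hh]; field_simp; ring
  have hupos : ∀ j : ℕ, 0 < u j := fun j => by
    simp only [hu]; positivity
  have humono : ∀ j : ℕ, u j ≤ u (j + 1) := fun j => by
    simp only [hu]; push_cast; nlinarith
  have husub : ∀ j : ℕ, u (j + 1) - u j = h := fun j => by
    simp only [hu]; push_cast; ring
  -- telescoping
  have htel : W (Real.exp ℓ) - W (Real.exp Λ) =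
      ∑ j ∈ Finset.range N, (W (Real.exp (u (j + 1))) - W (Real.exp (u j))) := by
    rw [Finset.sum_range_sub (fun j => W (Real.exp (u j))), hu0, huN]
  -- the bound on each window
  have hstep : ∀ j ∈ Finset.range N, W (Real.exp (u (j + 1))) - W (Real.exp (u j)) ≤
      (∫ v in u j..u (j + 1), |Real.cos (β / 2 * v)| / v) +
        |β| * h * (Real.log (u (j + 1)) - Real.log (u j)) + (1 + |β| * h / 2) * E := by
    intro j hj
    rw [Finset.mem_range] at hj
    set c : ℝ := |Real.cos (β / 2 * u j)| + |β| / 2 * h with hc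
    have hc0 : 0 ≤ c := by positivity
    have hc1 : c ≤ 1 + |β| * h / 2 := by
      have := Real.abs_cos_le_one (β / 2 * u j)
      rw [hc]; linarith
    have hexp : Real.exp (u j) ≤ Real.exp (u (j + 1)) := Real.exp_le_exp.mpr (humono j)
    -- primes in the window have `u j < log p ≤ u (j+1)`
    have hwinc : ∀ p : ℕ, p.Prime → Real.exp (u j) < p → (p : ℝ) ≤ Real.exp (u (j + 1)) →
        |Real.cos (β / 2 * Real.log p)| ≤ c := by
      intro p hp h1 h2
      have hp0 : (0 : ℝ) < p := by exact_mod_cast hp.pos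
      have hl1 : u j < Real.log p := (Real.lt_log_iff_exp_lt hp0).mpr h1
      have hl2 : Real.log p ≤ u (j + 1) := (Real.log_le_iff_le_exp hp0).mpr h2
      refine abs_cos_mul_le_of_abs_sub_le ?_
      rw [abs_of_nonneg (by linarith)]
      linarith [husub j]
    have h1 := cosLogSum_window_le (β := β) (Real.exp_pos _).le hexp hwinc
    have h2 : primeRecipSum (Real.exp (u (j + 1))) - primeRecipSum (Real.exp (u j)) ≤
        Real.log (u (j + 1)) - Real.log (u j) + E := hwin j hj
    have hdlog : 0 ≤ Real.log (u (j + 1)) - Real.log (u j) := by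
      have := Real.log_le_log (hupos j) (humono j); linarith
    have h3 := abs_cos_mul_log_sub_le_integral (β := β) (hupos j) (humono j)
    rw [husub j] at h3
    calc W (Real.exp (u (j + 1))) - W (Real.exp (u j))
        ≤ c * (primeRecipSum (Real.exp (u (j + 1))) - primeRecipSum (Real.exp (u j))) := h1
      _ ≤ c * (Real.log (u (j + 1)) - Real.log (u j) + E) := mul_le_mul_of_nonneg_left h2 hc0
      _ = |Real.cos (β / 2 * u j)| * (Real.log (u (j + 1)) - Real.log (u j)) +
            |β| / 2 * h * (Real.log (u (j + 1)) - Real.log (u j)) + c * E := by rw [hc]; ring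
      _ ≤ ((∫ v in u j..u (j + 1), |Real.cos (β / 2 * v)| / v) +
              |β| / 2 * h * (Real.log (u (j + 1)) - Real.log (u j))) +
            |β| / 2 * h * (Real.log (u (j + 1)) - Real.log (u j)) + (1 + |β| * h / 2) * E := by
          gcongr
      _ = _ := by ring
  -- summing the windows
  have hsum := Finset.sum_le_sum hstep
  rw [← htel, Finset.sum_add_distrib, Finset.sum_add_distrib, Finset.sum_const, Finset.card_range,
    nsmul_eq_mul, ← Finset.mul_sum, Finset.sum_range_sub (fun j => Real.log (u j)), hu0, huN,
    intervalIntegral.sum_integral_adjacent_intervals, hu0, huN] at hsum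
  · calc W (Real.exp ℓ) - W (Real.exp Λ)
        ≤ (∫ v in Λ..ℓ, |Real.cos (β / 2 * v)| / v) + |β| * h * (Real.log ℓ - Real.log Λ) +
            N * ((1 + |β| * h / 2) * E) := hsum
      _ = _ := by ring
  · intro k _
    exact (continuousOn_abs_cos_mul_div (hupos k) (humono k)).intervalIntegrable

/-! ### The main estimate for large `x` -/

/-- `exp(-c√Λ) ≤ ℓ^{-10}` once `√Λ ≥ (10/c) log ℓ` (`c > 0`, `ℓ > 0`). [folklore] -/
theorem exp_neg_mul_sqrt_le_pow {c Λ ℓ : ℝ} (hc : 0 < c) (hℓ : 0 < ℓ)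
    (h : 10 / c * Real.log ℓ ≤ Real.sqrt Λ) :
    Real.exp (-(c * Real.sqrt Λ)) ≤ (ℓ ^ 10)⁻¹ := by
  have h1 : 10 * Real.log ℓ ≤ c * Real.sqrt Λ := by
    have := mul_le_mul_of_nonneg_left h hc.le
    rwa [← mul_assoc, mul_div_cancel₀ _ hc.ne'] at this
  calc Real.exp (-(c * Real.sqrt Λ)) ≤ Real.exp (-(10 * Real.log ℓ)) := Real.exp_le_exp.mpr (by linarith)
    _ = (ℓ ^ 10)⁻¹ := by
        rw [Real.exp_neg, show (10 : ℝ) * Real.log ℓ = Real.log (ℓ ^ 10) by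
          rw [Real.log_pow]; norm_num, Real.exp_log (pow_pos hℓ 10)]

/-- Mertens' bound in the form `∑_{p ≤ t} |cos((β/2) log p)|/p ≤ ∑_{p ≤ t} 1/p ≤ log log t + 4`
for `t ≥ 2`. [folklore] -/
theorem cosLogSum_le_loglog {β t : ℝ} (ht : 2 ≤ t) :
    ∑ p ∈ Nat.primesLE ⌊t⌋₊, |Real.cos (β / 2 * Real.log p)| / p ≤ Real.log (Real.log t) + 4 := by
  have hN : 2 ≤ ⌊t⌋₊ := Nat.le_floor (by exact_mod_cast ht)
  have h1 : ∑ p ∈ Nat.primesLE ⌊t⌋₊, |Real.cos (β / 2 * Real.log p)| / p ≤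
      ∑ p ∈ Nat.primesLE ⌊t⌋₊, (1 : ℝ) / p := by
    refine Finset.sum_le_sum fun p hp => ?_
    have hp0 : (0 : ℝ) < p := by exact_mod_cast (Nat.mem_primesLE.mp hp).2.pos
    exact div_le_div_of_nonneg_right (Real.abs_cos_le_one _) hp0.le
  refine h1.trans ((Literature.NumberTheory.LFunctions.MertensBound.sum_inv_prime_le ⌊t⌋₊ hN).trans ?_)
  have hfl : (⌊t⌋₊ : ℝ) ≤ t := Nat.floor_le (by linarith)
  have hfl2 : (2 : ℝ) ≤ ⌊t⌋₊ := by exact_mod_cast hN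
  have := Real.log_le_log (Real.log_pos (by linarith)) (Real.log_le_log (by linarith) hfl)
  linarith

/-- **The large-`x` case with explicit constants.** Let `c > 0`, `K₁ ≥ 0` be constants for which the
windowed prime number theorem `|∑_{u < p ≤ v} 1/p - (log log v - log log u)| ≤ K₁ exp(-c√log u)`
(`2 ≤ u ≤ v`) holds. Let `ℓ = log x ≥ 1`, `|β| ≤ ℓ`, and let `Λ` satisfy
`1 ≤ Λ < ℓ`, `1/|β| ≤ Λ`, `√Λ ≥ (10/c) log ℓ`. Then
`∑_{p ≤ x} |cos((β/2) log p)|/p ≤ (2/π) log ℓ + (1 - 2/π) log Λ + 13 + 16 K₁`.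
[cite: GranvilleSoundararajan2003, proof of Lemma 2.3] -/
theorem cosLogSum_le_of_window {c K₁ : ℝ} (hc : 0 < c) (hK₁ : 0 ≤ K₁)
    (hwin : ∀ u v : ℝ, 2 ≤ u → u ≤ v →
      |primeRecipSum v - primeRecipSum u - (Real.log (Real.log v) - Real.log (Real.log u))| ≤
        K₁ * Real.exp (-(c * Real.sqrt (Real.log u))))
    {β ℓ Λ : ℝ} (hℓ1 : 1 ≤ ℓ) (hβ0 : β ≠ 0) (hβℓ : |β| ≤ ℓ) (hΛ1 : 1 ≤ Λ) (hΛℓ : Λ < ℓ)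
    (hβΛ : 1 / |β| ≤ Λ) (hcΛ : 10 / c * Real.log ℓ ≤ Real.sqrt Λ) :
    ∑ p ∈ Nat.primesLE ⌊Real.exp ℓ⌋₊, |Real.cos (β / 2 * Real.log p)| / p ≤
      2 / π * Real.log ℓ + (1 - 2 / π) * Real.log Λ + 13 + 16 * K₁ := by
  have hℓ0 : 0 < ℓ := by linarith
  have hΛ0 : 0 < Λ := by linarith
  have hβ : 0 < |β| := abs_pos.mpr hβ0
  have hlogΛ0 : 0 ≤ Real.log Λ := Real.log_nonneg hΛ1
  have hlogℓΛ : Real.log Λ ≤ Real.log ℓ := Real.log_le_log hΛ0 hΛℓ.le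
  -- parameters of the covering
  set N : ℕ := ⌈ℓ⌉₊ ^ 3 with hN
  have hceil : ℓ ≤ ⌈ℓ⌉₊ := Nat.le_ceil ℓ
  have hceil' : (⌈ℓ⌉₊ : ℝ) ≤ ℓ + 1 := (Nat.ceil_lt_add_one hℓ0.le).le
  have hNℓ : ℓ ^ 3 ≤ N := by
    rw [hN]; push_cast; gcongr
  have hNℓ' : (N : ℝ) ≤ (2 * ℓ) ^ 3 := by
    rw [hN]; push_cast
    calc (⌈ℓ⌉₊ : ℝ) ^ 3 ≤ (ℓ + 1) ^ 3 := by gcongr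
      _ ≤ (2 * ℓ) ^ 3 := by gcongr; linarith
  have hNpos : 0 < N := by
    rw [hN]; exact pow_pos (Nat.ceil_pos.mpr hℓ0) 3
  have hN0 : (0 : ℝ) < N := by exact_mod_cast hNpos
  set h : ℝ := (ℓ - Λ) / N with hh
  have hh0 : 0 ≤ h := div_nonneg (by linarith) hN0.le
  have hhℓ : h ≤ (ℓ ^ 2)⁻¹ := by
    rw [hh, div_le_iff₀ hN0]
    calc ℓ - Λ ≤ ℓ := by linarith
      _ = (ℓ ^ 2)⁻¹ * ℓ ^ 3 := by field_simp
      _ ≤ (ℓ ^ 2)⁻¹ * N := by gcongr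
  have hβh : |β| * h ≤ ℓ⁻¹ := by
    calc |β| * h ≤ ℓ * (ℓ ^ 2)⁻¹ := mul_le_mul hβℓ hhℓ hh0 hℓ0.le
      _ = ℓ⁻¹ := by field_simp
  have hℓinv : ℓ⁻¹ ≤ 1 := inv_le_one_of_one_le₀ hℓ1
  -- the window error `E = K₁ exp(-c√Λ) ≤ K₁ ℓ^{-10}`
  set E : ℝ := K₁ * Real.exp (-(c * Real.sqrt Λ)) with hE
  have hE0 : 0 ≤ E := by positivity
  have hEℓ : E ≤ K₁ * (ℓ ^ 10)⁻¹ :=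
    mul_le_mul_of_nonneg_left (exp_neg_mul_sqrt_le_pow hc hℓ0 hcΛ) hK₁
  -- the windowed prime number theorem on each window
  have hwin' : ∀ j : ℕ, j < N →
      primeRecipSum (Real.exp (Λ + (j + 1 : ℕ) * ((ℓ - Λ) / N))) -
          primeRecipSum (Real.exp (Λ + j * ((ℓ - Λ) / N))) ≤
        Real.log (Λ + (j + 1 : ℕ) * ((ℓ - Λ) / N)) - Real.log (Λ + j * ((ℓ - Λ) / N)) + E := by
    intro j _
    rw [← hh]
    have hju : Λ ≤ Λ + j * h := by nlinarith [hh0, (Nat.cast_nonneg j : (0 : ℝ) ≤ j)]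
    have hjv : Λ + j * h ≤ Λ + (j + 1 : ℕ) * h := by push_cast; nlinarith
    have h2u : (2 : ℝ) ≤ Real.exp (Λ + j * h) := by
      have : (2 : ℝ) ≤ Real.exp 1 := by have := Real.add_one_le_exp (1 : ℝ); linarith
      exact this.trans (Real.exp_le_exp.mpr (by linarith))
    have hw := hwin _ _ h2u (Real.exp_le_exp.mpr hjv)
    rw [Real.log_exp, Real.log_exp, abs_le] at hw
    have hmono : Real.exp (-(c * Real.sqrt (Λ + j * h))) ≤ Real.exp (-(c * Real.sqrt Λ)) := by
      apply Real.exp_le_exp.mpr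
      have := Real.sqrt_le_sqrt hju
      nlinarith
    have : K₁ * Real.exp (-(c * Real.sqrt (Λ + j * h))) ≤ E := mul_le_mul_of_nonneg_left hmono hK₁
    linarith [hw.2]
  -- (1) the primes `p ≤ Y = e^Λ`
  have hY2 : (2 : ℝ) ≤ Real.exp Λ := by
    have : (2 : ℝ) ≤ Real.exp 1 := by have := Real.add_one_le_exp (1 : ℝ); linarith
    exact this.trans (Real.exp_le_exp.mpr hΛ1)
  have hsmall := cosLogSum_le_loglog (β := β) hY2
  rw [Real.log_exp] at hsmall
  -- (2) the primes `Y < p ≤ x`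
  have hbig := cosLogSum_sub_le_integral β hΛ0 hΛℓ.le hNpos hE0 hwin'
  rw [← hh] at hbig
  -- (3) the integral
  have hint : ∫ u in Λ..ℓ, |Real.cos (β / 2 * u)| / u ≤ 2 / π * Real.log (ℓ / Λ) + 8 := by
    have heq : ∫ u in Λ..ℓ, |Real.cos (β / 2 * u)| / u = ∫ u in Λ..ℓ, |Real.cos (|β| / 2 * u)| / u := by
      refine integral_congr fun u _ => ?_
      show |Real.cos (β / 2 * u)| / u = |Real.cos (|β| / 2 * u)| / u
      rcases le_or_gt 0 β with hb | hb
      · rw [abs_of_nonneg hb]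
      · rw [abs_of_neg hb, show -β / 2 * u = -(β / 2 * u) by ring, Real.cos_neg]
    rw [heq]
    refine integral_abs_cos_mul_div_le (by positivity) hΛ0 hΛℓ.le ?_
    have hβne : |β| ≠ 0 := hβ.ne'
    have h1 : 1 ≤ |β| * Λ := by
      calc (1 : ℝ) = |β| * (1 / |β|) := by field_simp
        _ ≤ |β| * Λ := by gcongr
    linarith
  rw [Real.log_div hℓ0.ne' hΛ0.ne', mul_sub] at hint
  -- (4) the small terms
  have ht1 : |β| * h * (Real.log ℓ - Real.log Λ) ≤ 1 := by
    have hlogℓ : Real.log ℓ ≤ ℓ := (Real.log_le_sub_one_of_pos hℓ0).trans (by linarith)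
    calc |β| * h * (Real.log ℓ - Real.log Λ) ≤ ℓ⁻¹ * ℓ :=
          mul_le_mul hβh (by linarith) (by linarith) (by positivity)
      _ = 1 := inv_mul_cancel₀ hℓ0.ne'
  have ht2 : (N : ℝ) * (1 + |β| * h / 2) * E ≤ 16 * K₁ := by
    have h1 : 1 + |β| * h / 2 ≤ 2 := by linarith [hβh.trans hℓinv]
    have hpow : ℓ ^ 3 * (ℓ ^ 10)⁻¹ ≤ 1 := by
      rw [← div_eq_mul_inv, div_le_one (pow_pos hℓ0 10)]
      exact pow_le_pow_right₀ hℓ1 (by norm_num)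
    calc (N : ℝ) * (1 + |β| * h / 2) * E ≤ (2 * ℓ) ^ 3 * 2 * (K₁ * (ℓ ^ 10)⁻¹) := by
          gcongr
      _ = 16 * K₁ * (ℓ ^ 3 * (ℓ ^ 10)⁻¹) := by ring
      _ ≤ 16 * K₁ * 1 := mul_le_mul_of_nonneg_left hpow (by positivity)
      _ = 16 * K₁ := mul_one _
  -- assemble
  have hid : (1 - 2 / π) * Real.log Λ = Real.log Λ - 2 / π * Real.log Λ := by ring
  linarith [hsmall, hbig, hint, ht1, ht2, hid]

/-! ### The estimate for all `x ≥ 3` -/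

/-- **Granville–Soundararajan, proof of Lemma 2.3 — the prime sum**: there is an absolute `K` such
that for `x ≥ 3` and `1/log x ≤ |β| ≤ log x`,
`∑_{p ≤ x} |cos((β/2) log p)|/p ≤ (2/π) log log x + (1 - 2/π) log max(1/|β|, (log log x)²) + K`
("`∑_{p≤x} |cos((|β|/2)log p)|/p ≤ (2/π) log log x + (1 - 2/π) log log Y + O(1)`" with
`log Y = max(C (log log x)², 1/|β|)`). [cite: GranvilleSoundararajan2003, proof of Lemma 2.3] -/
theorem sum_abs_cos_log_prime_div_le :
    ∃ K : ℝ, ∀ x : ℝ, 3 ≤ x → ∀ β : ℝ, 1 / Real.log x ≤ |β| → |β| ≤ Real.log x →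
      ∑ p ∈ Nat.primesLE ⌊x⌋₊, |Real.cos (β / 2 * Real.log p)| / p ≤
        2 / π * Real.log (Real.log x) +
          (1 - 2 / π) * Real.log (max (1 / |β|) (Real.log (Real.log x) ^ 2)) + K := by
  obtain ⟨c, hc, K₀, hK₀⟩ := abs_primeRecipSum_window_sub_le_expSqrt
  -- make the constant nonnegative
  set K₁ : ℝ := max K₀ 0 with hK₁
  have hK₁0 : 0 ≤ K₁ := le_max_right _ _
  have hwin : ∀ u v : ℝ, 2 ≤ u → u ≤ v →
      |primeRecipSum v - primeRecipSum u - (Real.log (Real.log v) - Real.log (Real.log u))| ≤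
        K₁ * Real.exp (-(c * Real.sqrt (Real.log u))) := fun u v hu huv =>
    (hK₀ u v hu huv).trans (mul_le_mul_of_nonneg_right (le_max_left _ _) (Real.exp_pos _).le)
  set C' : ℝ := max (100 / c ^ 2) 1 with hC'
  have hC'1 : 1 ≤ C' := le_max_right _ _
  have hC'0 : 0 < C' := by linarith
  have hlogC' : 0 ≤ Real.log C' := Real.log_nonneg hC'1
  have hpi : 2 / π ≤ 1 := by
    rw [div_le_one Real.pi_pos]; linarith [Real.pi_gt_three]
  have hpi0 : 0 ≤ 2 / π := by positivity
  refine ⟨13 + 16 * K₁ + (1 - 2 / π) * Real.log C', fun x hx β hβ1 hβ2 => ?_⟩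
  set ℓ : ℝ := Real.log x with hℓ
  have hx0 : 0 < x := by linarith
  have hℓ1 : 1 < ℓ := by
    rw [hℓ, ← Real.log_exp 1]
    refine Real.log_lt_log (Real.exp_pos _) (lt_of_lt_of_le ?_ hx)
    have := Real.exp_one_lt_d9; norm_num at this; linarith
  have hℓ0 : 0 < ℓ := by linarith
  have hLL0 : 0 < Real.log ℓ := Real.log_pos hℓ1
  have hβ : 0 < |β| := lt_of_lt_of_le (by positivity) hβ1
  have hβ0 : β ≠ 0 := abs_pos.mp hβ
  set M : ℝ := max (1 / |β|) (Real.log ℓ ^ 2) with hM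
  have hM0 : 0 < M := lt_of_lt_of_le (by positivity) (le_max_left _ _)
  -- `log M ≥ -log ℓ`
  have hlogM : -Real.log ℓ ≤ Real.log M := by
    have h1 : 1 / ℓ ≤ M := (one_div_le_one_div_of_le hβ hβ2).trans (le_max_left _ _)
    have := Real.log_le_log (by positivity) h1
    rwa [one_div, Real.log_inv] at this
  have hA : 0 ≤ 2 / π * Real.log ℓ := mul_nonneg hpi0 hLL0.le
  have hB : 0 ≤ (1 - 2 / π) * Real.log C' := mul_nonneg (sub_nonneg.mpr hpi) hlogC'
  -- the trivial bound `∑ ≤ log log x + 4`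
  have htriv := cosLogSum_le_loglog (β := β) (by linarith : (2 : ℝ) ≤ x)
  rw [← hℓ] at htriv
  by_cases hLL : Real.log ℓ < 1
  · -- small `x`: everything is `O(1)`
    have h1 : (1 - 2 / π) * -Real.log ℓ ≤ (1 - 2 / π) * Real.log M :=
      mul_le_mul_of_nonneg_left hlogM (sub_nonneg.mpr hpi)
    have hid : (1 - 2 / π) * -Real.log ℓ = 2 / π * Real.log ℓ - Real.log ℓ := by ring
    linarith [htriv, h1, hid, hLL, hK₁0, hA, hB]
  push Not at hLL
  -- large `x`
  set Λ : ℝ := max (C' * Real.log ℓ ^ 2) (1 / |β|) with hΛ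
  have hΛ1 : 1 ≤ Λ := by
    have h1 : 1 ≤ Real.log ℓ ^ 2 := by nlinarith
    have h2 : Real.log ℓ ^ 2 ≤ C' * Real.log ℓ ^ 2 := le_mul_of_one_le_left (sq_nonneg _) hC'1
    exact (h1.trans h2).trans (le_max_left _ _)
  have hΛ0 : 0 < Λ := by linarith
  have hβΛ : 1 / |β| ≤ Λ := le_max_right _ _
  have hΛM : Λ ≤ C' * M := by
    rw [hΛ]
    refine max_le ?_ ?_
    · exact mul_le_mul_of_nonneg_left (le_max_right _ _) hC'0.le
    · calc 1 / |β| ≤ M := le_max_left _ _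
        _ = 1 * M := (one_mul M).symm
        _ ≤ C' * M := mul_le_mul_of_nonneg_right hC'1 hM0.le
  have hlogΛ : Real.log Λ ≤ Real.log C' + Real.log M := by
    rw [← Real.log_mul hC'0.ne' hM0.ne']
    exact Real.log_le_log hΛ0 hΛM
  have hcΛ : 10 / c * Real.log ℓ ≤ Real.sqrt Λ := by
    have h1 : C' * Real.log ℓ ^ 2 ≤ Λ := le_max_left _ _
    have h2 : (10 / c * Real.log ℓ) ^ 2 ≤ C' * Real.log ℓ ^ 2 := by
      calc (10 / c * Real.log ℓ) ^ 2 = 100 / c ^ 2 * Real.log ℓ ^ 2 := by ring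
        _ ≤ C' * Real.log ℓ ^ 2 := mul_le_mul_of_nonneg_right (le_max_left _ _) (sq_nonneg _)
    calc 10 / c * Real.log ℓ = Real.sqrt ((10 / c * Real.log ℓ) ^ 2) :=
          (Real.sqrt_sq (by positivity)).symm
      _ ≤ Real.sqrt Λ := Real.sqrt_le_sqrt (h2.trans h1)
  -- `(1 - 2/π) log Λ ≤ (1 - 2/π) log C' + (1 - 2/π) log M`
  have hE' : (1 - 2 / π) * Real.log Λ ≤ (1 - 2 / π) * Real.log C' + (1 - 2 / π) * Real.log M := by
    have := mul_le_mul_of_nonneg_left hlogΛ (sub_nonneg.mpr hpi)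
    rwa [mul_add] at this
  rcases le_or_gt ℓ Λ with hℓΛ | hΛℓ
  · -- `Y ≥ x`: the trivial bound suffices
    have hD : (1 - 2 / π) * Real.log ℓ ≤ (1 - 2 / π) * Real.log Λ :=
      mul_le_mul_of_nonneg_left (Real.log_le_log hℓ0 hℓΛ) (sub_nonneg.mpr hpi)
    have hid : (1 - 2 / π) * Real.log ℓ = Real.log ℓ - 2 / π * Real.log ℓ := by ring
    linarith [htriv, hD, hE', hid, hK₁0]
  · have hmain := cosLogSum_le_of_window hc hK₁0 hwin hℓ1.le hβ0 hβ2 hΛ1 hΛℓ hβΛ hcΛ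
    have hexpℓ : Real.exp ℓ = x := by rw [hℓ, Real.exp_log hx0]
    rw [hexpℓ] at hmain
    linarith [hmain, hE']

end Literature.NumberTheory.LFunctions.GranvilleSoundararajan
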